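import Summits.PneNP.PneNP.Theorems.ChebyshevTracialDesignPairContainmentMean
import Summits.PneNP.PneNP.Theorems.ChebyshevTracialDesignJuntaVirtualPositivity
import HarnessLib

/-!
# Cell pnp-psdrank, route `ChebyshevTracialDesign`: SMALL BALANCED SLABS ARE EXACTLY RIGID — for `f = 1[|U∩H₁| = |U∩H₂|]`, `u = χ_{H₁} − χ_{H₂}` with
# `2(|H₁|+|H₂|) ≤ D`, the pair-containment form vanishes at EVERY matching: `Σ_U W(U,M) f(U)·(Σ_p u_p x_p x_{π_M p})² = 0`
# (crux `TracialDecayExp20`, stmt-PneNP-19878)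

Brick 107 (prover g19; MEMO-22 §2(b), §4). Brick 105 (`…PairContainmentMean.sum_containment_sq_eq_zero_of_slab`) shows that a mask supported on a
slab `{Σ_{p∈U} u_p = 0}` has `Σ_M Q^f_M(u) = 0` EXACTLY (`Q^f_M(u) = Σ_U W(U,M) f(U) C_u(U)²`, `C_u(U) = Σ_p u_p x_p x_{π_M p}`), so (CG_1') in the fixed
direction `u` becomes the two-sided demand that `Q^f_M(u)` be small for essentially every `M`. For the BALANCED SLABS `f = 1[|U∩H₁| = |U∩H₂|]`,
`u = χ_{H₁} − χ_{H₂}` on FEW vertices this rigidity is exact: at a fixed matching `M₀` the function `U ↦ f(U)·C_u^{M₀}(U)²` is a cut-side JUNTA on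
`A = H ∪ π_{M₀}(H)`, `H = H₁ ∪ H₂` (`|A| ≤ 2|H|`), so for `2|H| ≤ D` (and `4|H| ≤ t + 2`, `4|H| + t ≤ n + 2`) junta virtual positivity
(`…JuntaVirtualPositivity.sum_levelWeight_trace_nonpos_of_junta`, with the matching side `δ_{M₀}`) gives `Q^f_{M₀}(u) ≤ 0` for EVERY `M₀`; a sum of
nonpositive terms that vanishes has all terms zero. THEOREMS: `containment_congr_of_inter_eq` (the junta property of `C_u`), `sum_indicator_sub_eq`
(`Σ_{p∈U} u_p = |U∩H₁| − |U∩H₂|`), `balancedSlab_value_nonpos` (per matching, `≤ 0`), **`balancedSlab_value_eq_zero`** (per matching, `= 0`).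
READING (MEMO-22 §4): the toy-scale fixed-direction defects of balanced slabs with `h = 3, 4` at `D = 2` (`Σ₊/μ ≈ 0.3–0.5`) are BEYOND-DEGREE junta
effects (`2|H| = 12, 16 > D`), of the same kind as the 2-junta's in MEMO-21 §7; the informative regime for eng's exact evaluation is `|H| ≫ D`
(`|H_i| = n/8, n/4`), where the slab is not a small junta and only the smoothness of the tilted level profile can make `Q^f_M(u)` small.
[cite: Rothvoss2017, §2 (PDF p. 6)] [cite: Grigoriev2001, Lemma 1.4 (PDF p. 8)] [cite: GriblingDelaatLaurent2019, §5]
Stature: support/instrument (kernel lane, no defs, axioms standard). WHAT THIS IS NOT: nothing for `|H| > D/2`, no proof or refutation of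
`TracialDecayExp20`, nothing on psd rank of P_PM(K_n), no P-vs-NP content. Supports stmt-PneNP-19878.
-/

set_option linter.dupNamespace false -- `Summit.PneNP.PneNP.…`: summit = sub-problem (D-0017)

noncomputable section

namespace Summit.PneNP.PneNP.Theorems.ChebyshevTracialDesignBalancedSlabRigidity

open Finset Matrix Literature.Barriers.PneNP Literature.Combinatorics.Optimization
open Summit.PneNP.PneNP.Theorems.ChebyshevTracialDesignPairContainmentMean (sum_containment_sq_eq_zero_of_slab)
open Summit.PneNP.PneNP.Theorems.ChebyshevTracialDesignJunta (sum_levelWeight_trace_nonpos_of_junta)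

variable {n : ℕ}

/-- **The containment form in direction `χ_{H₁} − χ_{H₂}` is a junta on `H ∪ π_M(H)`**, `H = H₁ ∪ H₂`: it takes the same value on two cuts with the same
trace on that set. [folklore] -/
theorem containment_congr_of_inter_eq (H₁ H₂ : Finset (Fin n)) (M : PMatch n) {U U' : OddSet n}
    (h : U.1 ∩ ((H₁ ∪ H₂) ∪ (H₁ ∪ H₂).image (M.2.partner)) = U'.1 ∩ ((H₁ ∪ H₂) ∪ (H₁ ∪ H₂).image (M.2.partner))) :
    ∑ p, ((if p ∈ H₁ then (1 : ℝ) else 0) - (if p ∈ H₂ then (1 : ℝ) else 0)) *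
        ((if p ∈ U.1 then (1 : ℝ) else 0) * (if M.2.partner p ∈ U.1 then (1 : ℝ) else 0)) =
      ∑ p, ((if p ∈ H₁ then (1 : ℝ) else 0) - (if p ∈ H₂ then (1 : ℝ) else 0)) *
        ((if p ∈ U'.1 then (1 : ℝ) else 0) * (if M.2.partner p ∈ U'.1 then (1 : ℝ) else 0)) := by
  classical
  set A : Finset (Fin n) := (H₁ ∪ H₂) ∪ (H₁ ∪ H₂).image (M.2.partner) with hA
  have hmem : ∀ z ∈ A, (z ∈ U.1 ↔ z ∈ U'.1) := fun z hz => by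
    constructor
    · intro hzU
      have : z ∈ U.1 ∩ A := mem_inter.2 ⟨hzU, hz⟩
      rw [h] at this; exact (mem_inter.1 this).1
    · intro hzU'
      have : z ∈ U'.1 ∩ A := mem_inter.2 ⟨hzU', hz⟩
      rw [← h] at this; exact (mem_inter.1 this).1
  refine sum_congr rfl fun p _ => ?_
  by_cases hp : p ∈ H₁ ∪ H₂
  · have hpA : p ∈ A := mem_union_left _ hp
    have hπA : M.2.partner p ∈ A := mem_union_right _ (mem_image_of_mem _ hp)
    simp only [hmem p hpA, hmem _ hπA]
  · have h1 : p ∉ H₁ := fun h' => hp (mem_union_left _ h')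
    have h2 : p ∉ H₂ := fun h' => hp (mem_union_right _ h')
    simp [h1, h2]

/-- `Σ_{p∈U} (1_{H₁}(p) − 1_{H₂}(p)) = |U∩H₁| − |U∩H₂|`. [folklore] -/
theorem sum_indicator_sub_eq (H₁ H₂ U : Finset (Fin n)) :
    ∑ p ∈ U, ((if p ∈ H₁ then (1 : ℝ) else 0) - (if p ∈ H₂ then (1 : ℝ) else 0)) = ((U ∩ H₁).card : ℝ) - ((U ∩ H₂).card : ℝ) := by
  classical
  rw [sum_sub_distrib]
  congr 1
  · rw [← sum_filter, sum_const, nsmul_eq_mul, mul_one, filter_mem_eq_inter]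
  · rw [← sum_filter, sum_const, nsmul_eq_mul, mul_one, filter_mem_eq_inter]

/-- **A small balanced slab has nonpositive pair-containment value at EVERY matching.** For an exact design of degree `D` and vertex sets `H₁, H₂`
with `2(|H₁|+|H₂|) ≤ D`, `4(|H₁|+|H₂|) ≤ t + 2`, `4(|H₁|+|H₂|) + t ≤ n + 2`, every `M`:
`Σ_U W(U,M)·1[|U∩H₁| = |U∩H₂|]·(Σ_p (1_{H₁}−1_{H₂})(p) x_p x_{π_M p})² ≤ 0`. [cite: Grigoriev2001, Lemma 1.4 (PDF p. 8)] [cite: Rothvoss2017, §2 (PDF p. 6)] -/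
theorem balancedSlab_value_nonpos {t T D : ℕ} {Bv : ℝ} {C : Finset ℕ} {w : ℕ → ℝ} (hdes : IsExactDesign n t T D Bv C w)
    (H₁ H₂ : Finset (Fin n)) (hD : 2 * (H₁.card + H₂.card) ≤ D) (ht : 4 * (H₁.card + H₂.card) ≤ t + 2)
    (hnt : 4 * (H₁.card + H₂.card) + t ≤ n + 2) (M : PMatch n) :
    ∑ U : OddSet n, levelWeight n t C w U M * ((if (U.1 ∩ H₁).card = (U.1 ∩ H₂).card then (1 : ℝ) else 0) *
      (∑ p, ((if p ∈ H₁ then (1 : ℝ) else 0) - (if p ∈ H₂ then (1 : ℝ) else 0)) *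
        ((if p ∈ U.1 then (1 : ℝ) else 0) * (if M.2.partner p ∈ U.1 then (1 : ℝ) else 0))) ^ 2) ≤ 0 := by
  classical
  set A : Finset (Fin n) := (H₁ ∪ H₂) ∪ (H₁ ∪ H₂).image (M.2.partner) with hA
  have hAcard : A.card ≤ 2 * (H₁.card + H₂.card) := by
    calc A.card ≤ (H₁ ∪ H₂).card + ((H₁ ∪ H₂).image (M.2.partner)).card := card_union_le _ _
      _ ≤ (H₁ ∪ H₂).card + (H₁ ∪ H₂).card := Nat.add_le_add_left card_image_le _
      _ ≤ (H₁.card + H₂.card) + (H₁.card + H₂.card) := Nat.add_le_add (card_union_le _ _) (card_union_le _ _)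
      _ = 2 * (H₁.card + H₂.card) := by ring
  -- the cut-side junta `X_U = (f(U) C_u(U)²)·1` and the matching side `δ_M`
  set g : OddSet n → ℝ := fun U => (if (U.1 ∩ H₁).card = (U.1 ∩ H₂).card then (1 : ℝ) else 0) *
    (∑ p, ((if p ∈ H₁ then (1 : ℝ) else 0) - (if p ∈ H₂ then (1 : ℝ) else 0)) *
      ((if p ∈ U.1 then (1 : ℝ) else 0) * (if M.2.partner p ∈ U.1 then (1 : ℝ) else 0))) ^ 2 with hg
  set X : OddSet n → Matrix (Fin 1) (Fin 1) ℝ := fun U => g U • (1 : Matrix (Fin 1) (Fin 1) ℝ) with hX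
  set Y : PMatch n → Matrix (Fin 1) (Fin 1) ℝ := fun M' => if M' = M then 1 else 0 with hY
  have hg0 : ∀ U, 0 ≤ g U := fun U => by
    rw [hg]; dsimp only
    exact mul_nonneg (by split_ifs <;> norm_num) (sq_nonneg _)
  have hXdep : ∀ U U' : OddSet n, U.1 ∩ A = U'.1 ∩ A → X U = X U' := by
    intro U U' hUU'
    have h1 : U.1 ∩ H₁ = U'.1 ∩ H₁ := by
      have := congrArg (fun S => S ∩ H₁) hUU'
      simp only [inter_assoc] at this
      rwa [show A ∩ H₁ = H₁ from inter_eq_right.2 (fun x hx => mem_union_left _ (mem_union_left _ hx))] at this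
    have h2 : U.1 ∩ H₂ = U'.1 ∩ H₂ := by
      have := congrArg (fun S => S ∩ H₂) hUU'
      simp only [inter_assoc] at this
      rwa [show A ∩ H₂ = H₂ from inter_eq_right.2 (fun x hx => mem_union_left _ (mem_union_right _ hx))] at this
    have h3 := containment_congr_of_inter_eq H₁ H₂ M hUU'
    rw [hX]; dsimp only; rw [hg]; dsimp only
    rw [h1, h2, h3]
  have hXpsd : ∀ U, (X U).PosSemidef := fun U => Matrix.PosSemidef.one.smul (hg0 U)
  have hYpsd : ∀ M', (Y M').PosSemidef := fun M' => by
    rw [hY]; dsimp only; split_ifs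
    · exact Matrix.PosSemidef.one
    · exact Matrix.PosSemidef.zero
  have h := sum_levelWeight_trace_nonpos_of_junta hdes A (hAcard.trans hD) (by omega) (by omega) X Y hXdep hXpsd hYpsd
  -- evaluate: only `M' = M` survives, and `tr(X_U) = g U`
  have hM : ∀ U : OddSet n, ∑ M' : PMatch n, levelWeight n t C w U M' * (X U * Y M').trace = levelWeight n t C w U M * g U := fun U => by
    have : ∀ M' : PMatch n, levelWeight n t C w U M' * (X U * Y M').trace =
        if M' = M then levelWeight n t C w U M * g U else 0 := fun M' => by
      rw [hY]; dsimp only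
      split_ifs with hM'
      · rw [hM', Matrix.mul_one, hX]; dsimp only
        rw [Matrix.trace_smul, Matrix.trace_one, Fintype.card_fin, Nat.cast_one, smul_eq_mul, mul_one]
      · rw [Matrix.mul_zero, Matrix.trace_zero, mul_zero]
    rw [sum_congr rfl fun M' _ => this M', Finset.sum_ite_eq' univ M, if_pos (mem_univ _)]
  simp_rw [hM] at h
  exact h

/-- **SMALL BALANCED SLABS ARE EXACTLY RIGID.** Under the hypotheses of `balancedSlab_value_nonpos` with `2 ≤ D`, for EVERY perfect matching `M`:
`Σ_U W(U,M)·1[|U∩H₁| = |U∩H₂|]·(Σ_p (1_{H₁}−1_{H₂})(p) x_p x_{π_M p})² = 0` — each term is `≤ 0` (junta virtual positivity) and their sum over `M`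
is `0` (the slab is mean-zero, brick 105). [cite: Grigoriev2001, Lemma 1.4 (PDF p. 8)] [cite: Rothvoss2017, §2 (PDF p. 6)] [cite: GriblingDelaatLaurent2019, §5] -/
theorem balancedSlab_value_eq_zero {t T D : ℕ} {Bv : ℝ} {C : Finset ℕ} {w : ℕ → ℝ} (hdes : IsExactDesign n t T D Bv C w) (hD2 : 2 ≤ D)
    (H₁ H₂ : Finset (Fin n)) (hD : 2 * (H₁.card + H₂.card) ≤ D) (ht : 4 * (H₁.card + H₂.card) ≤ t + 2)
    (hnt : 4 * (H₁.card + H₂.card) + t ≤ n + 2) (M : PMatch n) :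
    ∑ U : OddSet n, levelWeight n t C w U M * ((if (U.1 ∩ H₁).card = (U.1 ∩ H₂).card then (1 : ℝ) else 0) *
      (∑ p, ((if p ∈ H₁ then (1 : ℝ) else 0) - (if p ∈ H₂ then (1 : ℝ) else 0)) *
        ((if p ∈ U.1 then (1 : ℝ) else 0) * (if M.2.partner p ∈ U.1 then (1 : ℝ) else 0))) ^ 2) = 0 := by
  classical
  -- the sum over all matchings vanishes (mean-zero slab)
  have hslab : ∀ U : OddSet n, ∑ p ∈ U.1, ((if p ∈ H₁ then (1 : ℝ) else 0) - (if p ∈ H₂ then (1 : ℝ) else 0)) ≠ 0 →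
      (if (U.1 ∩ H₁).card = (U.1 ∩ H₂).card then (1 : ℝ) else 0) = 0 := by
    intro U hU
    rw [sum_indicator_sub_eq] at hU
    rw [if_neg]
    intro heq
    exact hU (by rw [heq, sub_self])
  have hsum := sum_containment_sq_eq_zero_of_slab hdes hD2
    (fun U : OddSet n => if (U.1 ∩ H₁).card = (U.1 ∩ H₂).card then (1 : ℝ) else 0)
    (fun p => (if p ∈ H₁ then (1 : ℝ) else 0) - (if p ∈ H₂ then (1 : ℝ) else 0)) hslab
  -- each term is `≤ 0`
  have hle : ∀ M' ∈ (univ : Finset (PMatch n)), ∑ U : OddSet n, levelWeight n t C w U M' *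
      ((if (U.1 ∩ H₁).card = (U.1 ∩ H₂).card then (1 : ℝ) else 0) *
        (∑ p, ((if p ∈ H₁ then (1 : ℝ) else 0) - (if p ∈ H₂ then (1 : ℝ) else 0)) *
          ((if p ∈ U.1 then (1 : ℝ) else 0) * (if M'.2.partner p ∈ U.1 then (1 : ℝ) else 0))) ^ 2) ≤ 0 :=
    fun M' _ => balancedSlab_value_nonpos hdes H₁ H₂ hD ht hnt M'
  exact (sum_eq_zero_iff_of_nonpos hle).1 hsum M (mem_univ _)

end Summit.PneNP.PneNP.Theorems.ChebyshevTracialDesignBalancedSlabRigidity
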